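import Mathlib
import HarnessLib
import Summits.ValiantsHypothesis.ValiantsHypothesis.Theorems.LacunarySymmetroidMatrixDescartesProductPlusOneSlopeConvexity

/-!
# LINE (A) `product_plus_one`, floor in W-currency (EB2-W): the ABSTRACT hump-versus-pull count, and the KNEE cell

✓ `…ProductPlusOneSlopeConvexity` proved the ρ_I = 1 cell (`oneRiser_slope_no_three_zeros`) from two convexity facts.  This file isolates the
abstract engine and adds the second row type whose slope is a log-concave hump — the one-signed BINOMIAL «knee» of the owner's certified extremal
family E(n) for `WronskianBudgetK3` (val-idea-25 g3, 2026-08-29 02:15Z: rows `1 + (x/S_j)^q`, two zeros of `W(P)` per knee):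

* ★ `slope_no_three_zeros_of_logConcave` — ANY row `A − Bx^p − Cx^q` (nonvanishing on the window) whose slope form is RISING (`ψ₁ < 0`, i.e.
  `s = θφ > 0`) and strictly LOG-CONCAVE (`ψ₁ψ₃ < ψ₂²`) on `[x₁, x₃] ⊂ (0,∞)`, against any weighted cloud of unswitched incoherent rows there:
  `ψ₁ + cloudP1` (`= −θΦ`) has no three zeros (Rolle ×2 on `log s − log n`, MVT on `ψ₂/ψ₁ − P2/P1`; ✓ `cloud_lcP1`);
* `binomial_slope_identity` — for a BINOMIAL row (`(Bx^p)·(Cx^q) = 0`): `ψ₂² − ψ₁ψ₃ = −2ψ₁³` (so a rising binomial slope is strictly log-concave,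
  whatever the signs of `A, B, C`: `binomial_slope_logConcave`);
* ★ `slope_logConcave_of_sign` — the general pointwise criterion: rising (`ψ₁ < 0`) and `βγ·A·u ≤ 0` ⇒ `ψ₁ψ₃ < ψ₂²`; instances: switched incoherent
  risers (✓ file above), binomial rows, and ★ `coherent_slope_logConcave` — an UNSWITCHED COHERENT `(+,+,−)` row in its rising phase; only one-signed
  trinomials (two knees) are excluded;
* `knee_rowPsi1_eq` / `knee_rowPsi1_neg` — a one-signed top knee in normal form (`B = 0`, `A·C < 0`: the line's row `(a₀, 0, a₂)` with `a₀a₂ > 0`)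
  has `ψ₁ = q²·(A·C)·x^q·u² < 0` at every `x > 0`: its slope `q²w(1−w)` is a rising hump everywhere;
* ★★ `oneKnee_slope_no_three_zeros` — ONE one-signed binomial knee against ANY weighted cloud of unswitched incoherent rows ⇒ `−θΦ` has no three
  zeros on any window `⊂ (0, t_min)`: each ISOLATED knee costs at most two zeros of `W(P)` against an incoherent pull (E(n)'s `2` per knee is the
  cost of a knee against a pull; several knees / knees in riser company = the multi-hump budget, OPEN);
* ★★ `oneCoherent_slope_no_three_zeros` — ONE unswitched coherent row in its rising phase against ANY unswitched incoherent cloud ⇒ `−θΦ` has no three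
  zeros on the window (owner's item (2), first instance).

HONEST FRAMING: local cell counts; the multi-hump law (`Σ_j s_j = n` with `k` log-concave humps ⇒ `≤ 2k` solutions?) is exactly the located
analytic kernel of AB4-riser / `WronskianBudgetK3` and is NOT proved here; `OneChangeFloorK3` / the stubs / `MatrixDescartes` OPEN; `VP ≠ VNP` NOT proved.
No definitions, no named facts; Mathlib + ✓ `…SlopeConvexity` only.
-/

set_option linter.dupNamespace false

namespace Summit.ValiantsHypothesis.ValiantsHypothesis.Theorems.LacunarySymmetroidMatrixDescartes

namespace ProductPlusOne

open Finset
open scoped BigOperators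

/-! ### §1 The abstract engine: a rising log-concave slope against a log-convex pull -/

/-- ★ **HUMP versus PULL.**  Row `A − Bx^p − Cx^q` nonvanishing on `[x₁, x₃] ⊂ (0,∞)` with RISING (`ψ₁ < 0`) and strictly LOG-CONCAVE
(`ψ₁ψ₃ < ψ₂²`) slope there; nonempty cloud `s` of unswitched incoherent rows (weights `m_i > 0`, `B_i, C_i ≥ 0`, `B_i + C_i > 0`).  Then
`rowPsi1 (row) + cloudP1` does not vanish at three points `x₁ < x₂ < x₃`. [this file's theorem] -/
theorem slope_no_three_zeros_of_logConcave (e₁ e₂ : ℕ) (a b c : ℝ)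
    {ι : Type*} (s : Finset ι) (hs : s.Nonempty) (m A B C : ι → ℝ) (hm : ∀ i ∈ s, 0 < m i)
    (hB : ∀ i ∈ s, 0 ≤ B i) (hC : ∀ i ∈ s, 0 ≤ C i) (hBC : ∀ i ∈ s, 0 < B i + C i)
    {x₁ x₂ x₃ : ℝ} (h0 : 0 < x₁) (h12 : x₁ < x₂) (h23 : x₂ < x₃)
    (hF : ∀ x ∈ Set.Icc x₁ x₃, a - b * x ^ (e₁ + 1) - c * x ^ (e₁ + e₂ + 2) ≠ 0)
    (hpost : ∀ x ∈ Set.Icc x₁ x₃, rowPsi1 e₁ e₂ a b c x < 0)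
    (hlc : ∀ x ∈ Set.Icc x₁ x₃, rowPsi1 e₁ e₂ a b c x * rowPsi3 e₁ e₂ a b c x < rowPsi2 e₁ e₂ a b c x ^ 2)
    (hun : ∀ x ∈ Set.Icc x₁ x₃, ∀ i ∈ s, 0 < A i - B i * x ^ (e₁ + 1) - C i * x ^ (e₁ + e₂ + 2))
    (hzero : ∀ x ∈ ({x₁, x₂, x₃} : Set ℝ), rowPsi1 e₁ e₂ a b c x + cloudP1 e₁ e₂ s m A B C x = 0) : False := by
  have hx0 : ∀ x ∈ Set.Icc x₁ x₃, 0 < x := fun x hx => h0.trans_le hx.1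
  have hsig := fun x (hx : x ∈ Set.Icc x₁ x₃) => cloud_signs e₁ e₂ (hx0 x hx) hs hm hB hC hBC (hun x hx)
  -- `F = log(−ψ₁) − log P1` vanishes at the three points
  have hFzero : ∀ x ∈ ({x₁, x₂, x₃} : Set ℝ),
      Real.log (-rowPsi1 e₁ e₂ a b c x) - Real.log (cloudP1 e₁ e₂ s m A B C x) = 0 := by
    intro x hx
    have h := hzero x hx
    have : -rowPsi1 e₁ e₂ a b c x = cloudP1 e₁ e₂ s m A B C x := by linarith
    rw [this, sub_self]
  have hFderiv : ∀ x ∈ Set.Icc x₁ x₃,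
      HasDerivAt (fun t => Real.log (-rowPsi1 e₁ e₂ a b c t) - Real.log (cloudP1 e₁ e₂ s m A B C t))
        ((rowPsi2 e₁ e₂ a b c x / rowPsi1 e₁ e₂ a b c x - cloudP2 e₁ e₂ s m A B C x / cloudP1 e₁ e₂ s m A B C x) / x) x := by
    intro x hx
    have hx' := hx0 x hx
    have h1 : HasDerivAt (fun t => -rowPsi1 e₁ e₂ a b c t) (-(rowPsi2 e₁ e₂ a b c x / x)) x :=
      (hasDerivAt_rowPsi1 e₁ e₂ a b c hx'.ne' (hF x hx)).neg
    have h1' := h1.log (by have := hpost x hx; linarith)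
    have h2 := (cloud_hasDerivAt1 e₁ e₂ s m A B C hx' (hun x hx)).log (hsig x hx).2.1.ne'
    refine (h1'.sub h2).congr_deriv ?_
    have hψ1ne : rowPsi1 e₁ e₂ a b c x ≠ 0 := (hpost x hx).ne
    have hP1ne : cloudP1 e₁ e₂ s m A B C x ≠ 0 := (hsig x hx).2.1.ne'
    have hxne : x ≠ 0 := hx'.ne'
    field_simp
  have hFcont : ∀ y z, x₁ ≤ y → z ≤ x₃ →
      ContinuousOn (fun t => Real.log (-rowPsi1 e₁ e₂ a b c t) - Real.log (cloudP1 e₁ e₂ s m A B C t)) (Set.Icc y z) :=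
    fun y z hy hz t ht => (hFderiv t ⟨hy.trans ht.1, ht.2.trans hz⟩).continuousAt.continuousWithinAt
  -- Rolle twice
  have hrolle : ∀ y z, x₁ ≤ y → y < z → z ≤ x₃ →
      Real.log (-rowPsi1 e₁ e₂ a b c y) - Real.log (cloudP1 e₁ e₂ s m A B C y) = 0 →
      Real.log (-rowPsi1 e₁ e₂ a b c z) - Real.log (cloudP1 e₁ e₂ s m A B C z) = 0 →
        ∃ η ∈ Set.Ioo y z, rowPsi2 e₁ e₂ a b c η / rowPsi1 e₁ e₂ a b c η
          - cloudP2 e₁ e₂ s m A B C η / cloudP1 e₁ e₂ s m A B C η = 0 := by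
    intro y z hy hyz hz hFy hFz
    obtain ⟨η, hη, hη'⟩ := exists_hasDerivAt_eq_zero hyz (hFcont y z hy hz) (hFy.trans hFz.symm)
      (fun t ht => hFderiv t ⟨hy.trans ht.1.le, ht.2.le.trans hz⟩)
    refine ⟨η, hη, ?_⟩
    have hη0 : 0 < η := hx0 η ⟨hy.trans hη.1.le, hη.2.le.trans hz⟩
    rcases div_eq_zero_iff.1 hη' with h | h
    · exact h
    · exact absurd h hη0.ne'
  obtain ⟨η₁, hη₁, hG1⟩ := hrolle x₁ x₂ le_rfl h12 h23.le (hFzero x₁ (by simp)) (hFzero x₂ (by simp))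
  obtain ⟨η₂, hη₂, hG2⟩ := hrolle x₂ x₃ h12.le h23 le_rfl (hFzero x₂ (by simp)) (hFzero x₃ (by simp))
  have hη12 : η₁ < η₂ := hη₁.2.trans hη₂.1
  -- `G = ψ₂/ψ₁ − P2/P1` has a negative derivative
  have hGderiv : ∀ x ∈ Set.Icc x₁ x₃, ∃ D : ℝ, D < 0 ∧
      HasDerivAt (fun t => rowPsi2 e₁ e₂ a b c t / rowPsi1 e₁ e₂ a b c t
        - cloudP2 e₁ e₂ s m A B C t / cloudP1 e₁ e₂ s m A B C t) D x := by
    intro x hx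
    have hx' := hx0 x hx
    have hψ1x : rowPsi1 e₁ e₂ a b c x < 0 := hpost x hx
    have hP1x : 0 < cloudP1 e₁ e₂ s m A B C x := (hsig x hx).2.1
    have d1 := hasDerivAt_rowPsi1 e₁ e₂ a b c hx'.ne' (hF x hx)
    have d2 := hasDerivAt_rowPsi2 e₁ e₂ a b c hx'.ne' (hF x hx)
    have c1 := cloud_hasDerivAt1 e₁ e₂ s m A B C hx' (hun x hx)
    have c2 := cloud_hasDerivAt2 e₁ e₂ s m A B C hx' (hun x hx)
    have hquot := (d2.div d1 hψ1x.ne).sub (c2.div c1 hP1x.ne')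
    have hris := hlc x hx
    have hcl := cloud_lcP1 e₁ e₂ hx' hm hB hC hBC (hun x hx)
    refine ⟨(rowPsi3 e₁ e₂ a b c x * rowPsi1 e₁ e₂ a b c x - rowPsi2 e₁ e₂ a b c x ^ 2) / (x * rowPsi1 e₁ e₂ a b c x ^ 2)
        - (cloudP3 e₁ e₂ s m A B C x * cloudP1 e₁ e₂ s m A B C x - cloudP2 e₁ e₂ s m A B C x ^ 2)
          / (x * cloudP1 e₁ e₂ s m A B C x ^ 2), ?_, ?_⟩
    · have t1 : (rowPsi3 e₁ e₂ a b c x * rowPsi1 e₁ e₂ a b c x - rowPsi2 e₁ e₂ a b c x ^ 2)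
          / (x * rowPsi1 e₁ e₂ a b c x ^ 2) < 0 :=
        div_neg_of_neg_of_pos (by linarith) (mul_pos hx' (sq_pos_iff.mpr hψ1x.ne))
      have t2 : 0 ≤ (cloudP3 e₁ e₂ s m A B C x * cloudP1 e₁ e₂ s m A B C x - cloudP2 e₁ e₂ s m A B C x ^ 2)
          / (x * cloudP1 e₁ e₂ s m A B C x ^ 2) :=
        div_nonneg (by linarith) (by positivity)
      linarith
    · refine (hquot.congr_of_eventuallyEq (Filter.Eventually.of_forall fun t => ?_)).congr_deriv ?_
      · simp only [Pi.sub_apply, Pi.div_apply]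
      · have hψ1ne : rowPsi1 e₁ e₂ a b c x ≠ 0 := hψ1x.ne
        have hP1ne : cloudP1 e₁ e₂ s m A B C x ≠ 0 := hP1x.ne'
        have hxne : x ≠ 0 := hx'.ne'
        field_simp
  have hGcont : ContinuousOn (fun t => rowPsi2 e₁ e₂ a b c t / rowPsi1 e₁ e₂ a b c t
      - cloudP2 e₁ e₂ s m A B C t / cloudP1 e₁ e₂ s m A B C t) (Set.Icc η₁ η₂) := fun t ht => by
    obtain ⟨D, _, hD⟩ := hGderiv t ⟨hη₁.1.le.trans ht.1, ht.2.trans hη₂.2.le⟩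
    exact hD.continuousAt.continuousWithinAt
  obtain ⟨ξ, hξ, hξ'⟩ := exists_deriv_eq_slope _ hη12 hGcont (fun t ht => by
    obtain ⟨D, _, hD⟩ := hGderiv t ⟨hη₁.1.le.trans ht.1.le, ht.2.le.trans hη₂.2.le⟩
    exact hD.differentiableAt.differentiableWithinAt)
  obtain ⟨D, hDneg, hD⟩ := hGderiv ξ ⟨hη₁.1.le.trans hξ.1.le, hξ.2.le.trans hη₂.2.le⟩
  rw [hD.deriv, hG1, hG2, sub_zero, zero_div] at hξ'
  exact hDneg.ne hξ'

/-! ### §2 Binomial rows: the slope of a knee -/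

section Row

variable (e₁ e₂ : ℕ) (A B C : ℝ)

/-- **Binomial slope identity:** if one of the two upper letters vanishes (`(Bx^p)·(Cx^q) = 0`) then `ψ₂² − ψ₁ψ₃ = −2ψ₁³`. [this file's lemma] -/
theorem binomial_slope_identity (x : ℝ) (hBC : (B * x ^ (e₁ + 1)) * (C * x ^ (e₁ + e₂ + 2)) = 0) :
    rowPsi2 e₁ e₂ A B C x ^ 2 - rowPsi1 e₁ e₂ A B C x * rowPsi3 e₁ e₂ A B C x = -2 * rowPsi1 e₁ e₂ A B C x ^ 3 := by
  rw [rowPsi_slope_identity, rowPsi1_eq_mul]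
  have : ((e₁ : ℝ) + 1) ^ 2 * ((e₁ : ℝ) + e₂ + 2) ^ 2 * ((e₂ : ℝ) + 1) ^ 2 * (B * x ^ (e₁ + 1)) * (C * x ^ (e₁ + e₂ + 2))
      = ((e₁ : ℝ) + 1) ^ 2 * ((e₁ : ℝ) + e₂ + 2) ^ 2 * ((e₂ : ℝ) + 1) ^ 2 * ((B * x ^ (e₁ + 1)) * (C * x ^ (e₁ + e₂ + 2))) := by ring
  rw [this, hBC]
  ring

/-- **A rising binomial slope is strictly log-concave** (any signs of `A, B, C`): `ψ₁ < 0 ⇒ ψ₁ψ₃ < ψ₂²`. [this file's lemma] -/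
theorem binomial_slope_logConcave (x : ℝ) (hBC : (B * x ^ (e₁ + 1)) * (C * x ^ (e₁ + e₂ + 2)) = 0)
    (hpost : rowPsi1 e₁ e₂ A B C x < 0) :
    rowPsi1 e₁ e₂ A B C x * rowPsi3 e₁ e₂ A B C x < rowPsi2 e₁ e₂ A B C x ^ 2 := by
  have h := binomial_slope_identity e₁ e₂ A B C x hBC
  have : 0 < -2 * rowPsi1 e₁ e₂ A B C x ^ 3 := by
    have h3 : rowPsi1 e₁ e₂ A B C x ^ 3 < 0 := by
      have := hpost
      calc rowPsi1 e₁ e₂ A B C x ^ 3 = rowPsi1 e₁ e₂ A B C x * rowPsi1 e₁ e₂ A B C x ^ 2 := by ring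
        _ < 0 := mul_neg_of_neg_of_pos hpost (sq_pos_iff.mpr hpost.ne)
    linarith
  linarith

/-- ★ **General slope log-concavity by sign** (every row): if the slope form is rising (`ψ₁ < 0`) and `(Bx^p)·(Cx^q)·A·u ≤ 0` then
`ψ₁ψ₃ < ψ₂²`.  Covers: switched incoherent risers (`u < 0`, `B, C ≥ 0`, `A ≥ 0` — ✓ `riser_slope_logConcave`), binomial rows (`βγ = 0`), AND
UNSWITCHED COHERENT rows in their rising phase (`u > 0`, `B ≤ 0 ≤ C`, `A > 0`); excluded: one-signed trinomials (two knees). [this file's theorem] -/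
theorem slope_logConcave_of_sign {x : ℝ} (hF : A - B * x ^ (e₁ + 1) - C * x ^ (e₁ + e₂ + 2) ≠ 0)
    (hsign : (B * x ^ (e₁ + 1)) * (C * x ^ (e₁ + e₂ + 2)) * (A * rowU e₁ e₂ A B C x) ≤ 0)
    (hpost : rowPsi1 e₁ e₂ A B C x < 0) :
    rowPsi1 e₁ e₂ A B C x * rowPsi3 e₁ e₂ A B C x < rowPsi2 e₁ e₂ A B C x ^ 2 := by
  have hid := rowPsi_slope_identity e₁ e₂ A B C x
  have hψ1 := rowPsi1_eq_mul e₁ e₂ A B C x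
  set u := rowU e₁ e₂ A B C x with hudef
  set E := rowH e₁ e₂ 2 B C x + rowH e₁ e₂ 1 B C x ^ 2 * u with hE
  have hune : u ≠ 0 := by rw [hudef]; unfold rowU; exact inv_ne_zero hF
  -- `ψ₁ = uE < 0` ⇒ `−2uE³ = −2(uE)·E² > 0`
  have hcube : 0 < -2 * u * E ^ 3 := by
    have hE0 : E ≠ 0 := by intro h; rw [hψ1, h, mul_zero] at hpost; exact lt_irrefl 0 hpost
    have : -2 * u * E ^ 3 = -2 * (u * E) * E ^ 2 := by ring
    rw [this]
    have huE : u * E < 0 := by rw [hψ1] at hpost; exact hpost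
    have hE2 : 0 < E ^ 2 := sq_pos_iff.mpr hE0
    nlinarith
  have hAu : rowH e₁ e₂ 0 B C x * u + 1 = A * u := by rw [hudef]; exact rowH0_mul_rowU_add_one e₁ e₂ A B C hF
  have hterm2 : 0 ≤ -(((e₁ : ℝ) + 1) ^ 2 * ((e₁ : ℝ) + e₂ + 2) ^ 2 * ((e₂ : ℝ) + 1) ^ 2 * (B * x ^ (e₁ + 1))
      * (C * x ^ (e₁ + e₂ + 2)) * (rowH e₁ e₂ 0 B C x * u + 1)) := by
    rw [hAu]
    have hc : 0 ≤ ((e₁ : ℝ) + 1) ^ 2 * ((e₁ : ℝ) + e₂ + 2) ^ 2 * ((e₂ : ℝ) + 1) ^ 2 := by positivity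
    have : ((e₁ : ℝ) + 1) ^ 2 * ((e₁ : ℝ) + e₂ + 2) ^ 2 * ((e₂ : ℝ) + 1) ^ 2 * (B * x ^ (e₁ + 1)) * (C * x ^ (e₁ + e₂ + 2)) * (A * u)
        = (((e₁ : ℝ) + 1) ^ 2 * ((e₁ : ℝ) + e₂ + 2) ^ 2 * ((e₂ : ℝ) + 1) ^ 2)
          * ((B * x ^ (e₁ + 1)) * (C * x ^ (e₁ + e₂ + 2)) * (A * u)) := by ring
    rw [this]
    have := mul_nonpos_of_nonneg_of_nonpos hc hsign
    linarith
  have hu2 : 0 < u ^ 2 := sq_pos_iff.mpr hune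
  have : 0 < rowPsi2 e₁ e₂ A B C x ^ 2 - rowPsi1 e₁ e₂ A B C x * rowPsi3 e₁ e₂ A B C x := by
    rw [hid]; exact mul_pos hu2 (by linarith)
  linarith

/-- ★ **COHERENT row, unswitched, rising phase:** normal form `A > 0`, `B ≤ 0 ≤ C` (the line's `(+,+,−)` row before its zero, `u > 0`) with rising slope
(`ψ₁ < 0`) ⇒ `ψ₁ψ₃ < ψ₂²`. [this file's theorem] -/
theorem coherent_slope_logConcave {x : ℝ} (hx : 0 < x) (hA : 0 < A) (hB : B ≤ 0) (hC : 0 ≤ C)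
    (hF : 0 < A - B * x ^ (e₁ + 1) - C * x ^ (e₁ + e₂ + 2)) (hpost : rowPsi1 e₁ e₂ A B C x < 0) :
    rowPsi1 e₁ e₂ A B C x * rowPsi3 e₁ e₂ A B C x < rowPsi2 e₁ e₂ A B C x ^ 2 := by
  refine slope_logConcave_of_sign e₁ e₂ A B C hF.ne' ?_ hpost
  have hu : 0 < rowU e₁ e₂ A B C x := rowU_pos e₁ e₂ A B C hF
  have hβ : B * x ^ (e₁ + 1) ≤ 0 := mul_nonpos_of_nonpos_of_nonneg hB (pow_pos hx _).le
  have hγ : 0 ≤ C * x ^ (e₁ + e₂ + 2) := by positivity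
  have hAu : 0 ≤ A * rowU e₁ e₂ A B C x := by positivity
  exact mul_nonpos_of_nonpos_of_nonneg (mul_nonpos_of_nonpos_of_nonneg hβ hγ) hAu

/-- **The top knee in normal form** (`B = 0`): `ψ₁ = q²·(A·C)·x^q·u²`. [this file's lemma] -/
theorem knee_rowPsi1_eq {x : ℝ} (hF : A - C * x ^ (e₁ + e₂ + 2) ≠ 0) :
    rowPsi1 e₁ e₂ A 0 C x = ((e₁ : ℝ) + e₂ + 2) ^ 2 * (A * C) * x ^ (e₁ + e₂ + 2) * rowU e₁ e₂ A 0 C x ^ 2 := by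
  unfold rowPsi1 rowH rowU
  simp only [mul_zero, zero_mul, zero_add, sub_zero]
  field_simp
  ring

/-- **A one-signed top knee rises everywhere:** `B = 0`, `A·C < 0` (the line's row `(a₀, 0, a₂)` with `a₀a₂ > 0`, normal form
`(a₀, 0, −a₂)`) ⇒ `ψ₁ < 0` at every `x > 0`. [this file's lemma] -/
theorem knee_rowPsi1_neg {x : ℝ} (hx : 0 < x) (hAC : A * C < 0) :
    rowPsi1 e₁ e₂ A 0 C x < 0 := by
  have hF : A - C * x ^ (e₁ + e₂ + 2) ≠ 0 := by
    intro h
    have hA : A = C * x ^ (e₁ + e₂ + 2) := by linarith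
    rw [hA] at hAC
    have : 0 ≤ C * x ^ (e₁ + e₂ + 2) * C := by
      have := sq_nonneg C; nlinarith [pow_pos hx (e₁ + e₂ + 2)]
    linarith
  rw [knee_rowPsi1_eq e₁ e₂ A C hF]
  have hu : rowU e₁ e₂ A 0 C x ≠ 0 := by
    unfold rowU; simp only [zero_mul, sub_zero]; exact inv_ne_zero hF
  have h1 : 0 < ((e₁ : ℝ) + e₂ + 2) ^ 2 := by positivity
  have h2 : 0 < x ^ (e₁ + e₂ + 2) := pow_pos hx _
  have h3 : 0 < rowU e₁ e₂ A 0 C x ^ 2 := sq_pos_iff.mpr hu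
  have : 0 < ((e₁ : ℝ) + e₂ + 2) ^ 2 * (-(A * C)) * x ^ (e₁ + e₂ + 2) * rowU e₁ e₂ A 0 C x ^ 2 := by
    have hn : 0 < -(A * C) := by linarith
    positivity
  linarith

end Row

/-! ### §3 The knee cell -/

/-- ★★ **ONE ONE-SIGNED BINOMIAL KNEE AGAINST ANY INCOHERENT CLOUD ⇒ `−θΦ` HAS NO THREE ZEROS** on a window `[x₁, x₃] ⊂ (0,∞)` on which the
cloud is unswitched (knee in normal form `A − C x^q` with `A·C < 0`; cloud as in ✓ `oneRiser_slope_no_three_zeros`).  Each isolated knee costs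
at most two zeros of `W(P)` against an incoherent pull. [this file's theorem] -/
theorem oneKnee_slope_no_three_zeros (e₁ e₂ : ℕ) {a c : ℝ} (hac : a * c < 0)
    {ι : Type*} (s : Finset ι) (hs : s.Nonempty) (m A B C : ι → ℝ) (hm : ∀ i ∈ s, 0 < m i)
    (hB : ∀ i ∈ s, 0 ≤ B i) (hC : ∀ i ∈ s, 0 ≤ C i) (hBC : ∀ i ∈ s, 0 < B i + C i)
    {x₁ x₂ x₃ : ℝ} (h0 : 0 < x₁) (h12 : x₁ < x₂) (h23 : x₂ < x₃)
    (hun : ∀ x ∈ Set.Icc x₁ x₃, ∀ i ∈ s, 0 < A i - B i * x ^ (e₁ + 1) - C i * x ^ (e₁ + e₂ + 2))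
    (hzero : ∀ x ∈ ({x₁, x₂, x₃} : Set ℝ), rowPsi1 e₁ e₂ a 0 c x + cloudP1 e₁ e₂ s m A B C x = 0) : False := by
  have hx0 : ∀ x ∈ Set.Icc x₁ x₃, 0 < x := fun x hx => h0.trans_le hx.1
  have hF : ∀ x ∈ Set.Icc x₁ x₃, a - 0 * x ^ (e₁ + 1) - c * x ^ (e₁ + e₂ + 2) ≠ 0 := by
    intro x hx h
    have hx' := hx0 x hx
    have ha : a = c * x ^ (e₁ + e₂ + 2) := by linarith
    rw [ha] at hac
    have : 0 ≤ c * x ^ (e₁ + e₂ + 2) * c := by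
      have := sq_nonneg c; nlinarith [pow_pos hx' (e₁ + e₂ + 2)]
    linarith
  have hpost : ∀ x ∈ Set.Icc x₁ x₃, rowPsi1 e₁ e₂ a 0 c x < 0 := fun x hx => knee_rowPsi1_neg e₁ e₂ a c (hx0 x hx) hac
  refine slope_no_three_zeros_of_logConcave e₁ e₂ a 0 c s hs m A B C hm hB hC hBC h0 h12 h23 hF hpost
    (fun x hx => binomial_slope_logConcave e₁ e₂ a 0 c x (by ring) (hpost x hx)) hun hzero

/-- ★★ **ONE UNSWITCHED COHERENT ROW IN ITS RISING PHASE AGAINST ANY INCOHERENT CLOUD ⇒ `−θΦ` HAS NO THREE ZEROS** (coherent row in normal form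
`A > 0`, `B ≤ 0 ≤ C`, unswitched on `[x₁, x₃]`, with rising slope `ψ₁ < 0` there — the «knee before the pull» of a `(+,+,−)` row; cloud as before).
The owner's item (2) «coherent rows in the company», first instance. [this file's theorem] -/
theorem oneCoherent_slope_no_three_zeros (e₁ e₂ : ℕ) {a b c : ℝ} (ha : 0 < a) (hb : b ≤ 0) (hc : 0 ≤ c)
    {ι : Type*} (s : Finset ι) (hs : s.Nonempty) (m A B C : ι → ℝ) (hm : ∀ i ∈ s, 0 < m i)
    (hB : ∀ i ∈ s, 0 ≤ B i) (hC : ∀ i ∈ s, 0 ≤ C i) (hBC : ∀ i ∈ s, 0 < B i + C i)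
    {x₁ x₂ x₃ : ℝ} (h0 : 0 < x₁) (h12 : x₁ < x₂) (h23 : x₂ < x₃)
    (hun0 : ∀ x ∈ Set.Icc x₁ x₃, 0 < a - b * x ^ (e₁ + 1) - c * x ^ (e₁ + e₂ + 2))
    (hpost : ∀ x ∈ Set.Icc x₁ x₃, rowPsi1 e₁ e₂ a b c x < 0)
    (hun : ∀ x ∈ Set.Icc x₁ x₃, ∀ i ∈ s, 0 < A i - B i * x ^ (e₁ + 1) - C i * x ^ (e₁ + e₂ + 2))
    (hzero : ∀ x ∈ ({x₁, x₂, x₃} : Set ℝ), rowPsi1 e₁ e₂ a b c x + cloudP1 e₁ e₂ s m A B C x = 0) : False :=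
  slope_no_three_zeros_of_logConcave e₁ e₂ a b c s hs m A B C hm hB hC hBC h0 h12 h23 (fun x hx => (hun0 x hx).ne') hpost
    (fun x hx => coherent_slope_logConcave e₁ e₂ a b c (h0.trans_le hx.1) ha hb hc (hun0 x hx) (hpost x hx)) hun hzero

/-- The riser cell of ✓ `…SlopeConvexity` is the other instance of the engine (switched incoherent two-letter riser, `a ≥ 0`). -/
example (e₁ e₂ : ℕ) {a b c : ℝ} (ha : 0 ≤ a) (hb : 0 < b) (hc : 0 < c)
    {ι : Type*} (s : Finset ι) (hs : s.Nonempty) (m A B C : ι → ℝ) (hm : ∀ i ∈ s, 0 < m i)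
    (hB : ∀ i ∈ s, 0 ≤ B i) (hC : ∀ i ∈ s, 0 ≤ C i) (hBC : ∀ i ∈ s, 0 < B i + C i)
    {x₁ x₂ x₃ : ℝ} (h0 : 0 < x₁) (h12 : x₁ < x₂) (h23 : x₂ < x₃)
    (hsw : ∀ x ∈ Set.Icc x₁ x₃, a - b * x ^ (e₁ + 1) - c * x ^ (e₁ + e₂ + 2) < 0)
    (hpost : ∀ x ∈ Set.Icc x₁ x₃, rowPsi1 e₁ e₂ a b c x < 0)
    (hun : ∀ x ∈ Set.Icc x₁ x₃, ∀ i ∈ s, 0 < A i - B i * x ^ (e₁ + 1) - C i * x ^ (e₁ + e₂ + 2))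
    (hzero : ∀ x ∈ ({x₁, x₂, x₃} : Set ℝ), rowPsi1 e₁ e₂ a b c x + cloudP1 e₁ e₂ s m A B C x = 0) : False :=
  slope_no_three_zeros_of_logConcave e₁ e₂ a b c s hs m A B C hm hB hC hBC h0 h12 h23 (fun x hx => (hsw x hx).ne) hpost
    (fun x hx => riser_slope_logConcave e₁ e₂ a b c (h0.trans_le hx.1) ha hb.le hc.le (hsw x hx) (hpost x hx)) hun hzero

end ProductPlusOne

end Summit.ValiantsHypothesis.ValiantsHypothesis.Theorems.LacunarySymmetroidMatrixDescartes
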